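import Summits.SmoothPoincare4.SmoothPoincare4.Theses.ThreePointSpheres
import Literature.Topology.FourManifolds.FramedWhitneyDisc
import HarnessLib
import HarnessLib.Audit

/-!
# Birth skeleton (BC3) for crux `ThreePointSpheres.ThreePointCancellation` (item stmt-SmoothPoincare4-11168)

`Cruxes/ThreePointCancellation/Lines/birth.lean` · registrar planner-skel-stmt-SmoothPoincare4-11168-0 ·
2026-08-17 · mode skeleton-register (route re-audit bin REPAIRABLE; route
`route-SmoothPoincare4-ThreePointSpheres`, crux rank 3).  The crux is FIXED and is concluded BY NAME:

  `Summit.SmoothPoincare4.SmoothPoincare4.Theses.ThreePointSpheres.ThreePointCancellation`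

CANCEL₃ = RUNG(P₀): for a smooth homotopy 4-sphere `(M, e : M ≃ₕ S⁴)` (bare binders of the Statement),
a closed simply connected smooth oriented `N⁴` and ONE pair `(S, P)` of framed embedded 2-spheres in `N`
(`FramedSphereFamily (𝓡 4) N (Fin 1) 2 2`) which is algebraically dual (transverse, `S·P = 1`) with
exactly three double points, if surgery along `P` gives `S⁴` and surgery along `S` gives `M`, then
`M ≅ S⁴`.

## The cut — the route's own two-layer plan, typed (clean Whitney disc ∘ Whitney move ∘ Milnor)

The route header (TWO-LAYER PLAN) foresees `ThreePointCancellation ⇐ DualVisibleCancellation →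
DualInvisibleVanishes`, blocked at filing time on definition request D2 (a 4-dimensional framed
Whitney disc).  D2 has since LANDED as `Literature.Topology.FourManifolds.FramedWhitneyDisc`
(`FramedWhitneyDisc.lean`, with the Whitney move `FreedmanQuinn1990_whitneyMove` PROVED in
`FramedWhitneyDiscProofs.lean`), so the plan can now be typed.  This skeleton types it as THREE
registered stubs, each handing the next a different object (a clean framed Whitney disc `W` ↦ a
GEOMETRICALLY dual presentation `(S', P')` ↦ the diffeomorphism `M ≅ S⁴`):

* `stub_cleanWhitneyDisc` (OPEN — THE DUAL-INVISIBLE RESIDUE = `DualInvisibleVanishes`; the whole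
  open weight of the crux): under the crux's hypotheses VERBATIM, `M` admits IN THE SAME `N` a
  three-point algebraically dual presentation `(S₁, P₁)` from `S⁴` (possibly the given one: any pair
  isotopic to `(S, P)` has a clean disc iff `(S, P)` has, so the freedom offered is re-choosing the pair
  beyond isotopy) together with a framed Whitney disc `W` pairing two of the three double points whose
  INTERIOR MISSES `S₁ ∪ P₁` (`W.interiorMeets = ∅`; grading `w = 0` of the card).  Why plausibly true:
  `N ≅ S² × S²` with `P ≃ pt × S²`, `[S] = [S² × pt]` (even form, `S·P = 1`, `S·S = P·P = 0`); the
  finger-move model (refuter witness, CRUX-ATTACK.md 2026-08-15) has such a disc by construction, and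
  the bet of the route is that at `b₂(N) = 2` with a homotopy-sphere output the one Whitney circle can
  always be capped cleanly (light-bulb heuristics: Gabai2020, Schwartz2021, KosanovicTeichner2021 cover
  the neighbouring dual-visible / wrapping-number-1 sectors).  Why it might fail: this is SPC4 for
  P₀-twists — a pair all of whose framed Whitney discs meet `S ∪ P` inside, not improvable within `N`,
  would surger to an exotic `S⁴` candidate (Ladu2025ComplexityTwo §1: the Akbulut and DHM corks are
  P₀-supported; at `b⁺ ≥ 1` the analogue is FALSE).  Size: open-problem.
* `stub_whitneyMoveToDual` (KNOWN mathematics; M–L to formalise — THE WHITNEY MOVE READ ON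
  PRESENTATIONS = `DualVisibleCancellation` minus Milnor): for ANY target manifolds `X₁`, `X₂`, a
  three-point algebraically dual pair `(S, P)` in `N` with `P`-surgery `X₁`, `S`-surgery `X₂` and a clean
  framed Whitney disc on two of its double points can be replaced by a GEOMETRICALLY dual pair
  `(S', P')` in `N` (one transverse point of sign `+1`) with the same two surgery outcomes.  Proof in
  print / in tree: the Whitney move (`FreedmanQuinn1990_whitneyMove_holds`, PROVED) is an ambient
  isotopy `Φ` of `N` supported near `W(D̄)` with `doublePoints S (Φ₁ ∘ P) = {q₃}`; take `S' = S`,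
  `P' = Φ₁ ∘ P` (push-forward of the framed family, `FramedSphereFamily.exists_map_diffeomorph`), whose
  surgery is still `X₁` (`IsSurgery.of_map_diffeomorph`, PROVED); choosing the support off the third
  crossing keeps it transverse, one transverse point has intersection number `±1`
  (`intersectionNumber_eq_one_or_eq_neg_one_of_doublePoints_eq_singleton`), and the sign is made `+1`
  by re-orienting `P'` (`intersectionNumber_neg_right`).  Why it might fail: only as typed (the
  immersion/embedding side conditions of the move are discharged from `FramedSphereFamily`).
  [FreedmanQuinnPMS1990 §1.4; MilnorHCobordism1965 Thm. 6.6; Kirby1989 XII §1]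
* `stub_onePointCancellation` (KNOWN; L — MILNOR CANCELLATION, rung `C = 0`): literally the route's
  support item `ThreePointSpheres.OnePointCancellation` (stmt-SmoothPoincare4-11170) BY NAME: a
  geometrically dual one-pair presentation of `M` from `S⁴` gives `M ≅ S⁴` (`ν(S ∪ P)` is a punctured
  `S² × S²`, both surgeries return `N₀`, `M ≅ N₀ ≅ S⁴`).  [MilnorHCobordism1965 Thms 5.4/6.4;
  KirbyCorks1996 §1; GompfStipsicz1999 §5.2; Matveyev1996]

`ThreePointCancellation_of : Sig.stub_cleanWhitneyDisc → Sig.stub_whitneyMoveToDual →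
OnePointCancellation → ThreePointCancellation` is PROVED (§3, pure logic: improve the presentation,
move, cancel); `threePointCancellation_of_stubs : ThreePointCancellation` is the crux by name modulo
the three registered stubs.  `lean check`: sorries ONLY in the three `stub_*`.

Hardest stub: `stub_cleanWhitneyDisc` (the only open one; it is where the crux's `why_might_fail`
lives).  The other two are classical: `stub_whitneyMoveToDual` sits directly on the tree's proved
Whitney move and transport lemmas (M–L), `stub_onePointCancellation` is item 11170 (L, grounded
"known mathematics with heavy proved infrastructure in tree").

Honesty notes.  (1) `stub_onePointCancellation`, like the crux itself (refuter notes 2026-08-15,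
W.lean/W3.lean: `SmoothPoincare4 → ThreePointCancellation` with every presentation hypothesis unused),
is a CONSEQUENCE of `SmoothPoincare4` at theorem level; `stub_cleanWhitneyDisc` and
`stub_whitneyMoveToDual` are not (they assert configurations inside `N`, which `SmoothPoincare4` does
not mention).  None is cheaply equivalent to the crux or to the summit (BC3 probes below).  (2) The
composite `stub_whitneyMoveToDual ∘ stub_onePointCancellation` is the route's foreseen child
`DualVisibleCancellation`; `stub_cleanWhitneyDisc` is its foreseen child `DualInvisibleVanishes`
weakened by the freedom to re-choose the three-point pair inside `N` — so this skeleton IS the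
planner-sanctioned depth-1 split, now typable.  (3) `stub_whitneyMoveToDual` is stated for arbitrary
targets `X₁`, `X₂` and without `CompactSpace N` / `SimplyConnectedSpace N` / `e`: the extra generality
is what the proof gives (transport along a diffeomorphism of `N` is target-blind).  (4) Orientations:
the new pair comes with its own sphere orientations `oS'`, `oP'` (∃-bound), the ambient `oN` is kept.

BC3 probes (registrar, 2026-08-17, files `bc/probe_stub_*.lean` in the registrar's folder — §1 of this
file verbatim plus the probes, NO sorried theorem in scope; raw `lean check` output quoted in its
NOTES.md and in `Lines/birth.md`): 24 probes = 3 stubs × {`→ ThreePointCancellation`,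
`→ SmoothPoincare4`} × {`exact?`, `simpa [X]`, `(unfold X target; simpa)`, `aesop`}, one `example` each
under `maxHeartbeats 400000`: ALL FAIL — `exact?` "could not close the goal" 6/6, `aesop` "failed to
prove the goal after exhaustive search" 6/6, `simpa` / `unfold; simpa` heartbeat time-out at `whnf` /
`simp` (8, the two `Sig` stubs) or `assumption` failed on the residual goal (4, `OnePointCancellation`).
No stub is cheaply the crux or the summit.

Disproof used: none exists for this crux (`ledger crux ls stmt-SmoothPoincare4-11168`: no workfiles,
no `Disproof.lean`, no `Theorems/ThreePointCancellation/Negative/*`, 2026-08-17); negatives index of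
the summit consulted (`ledger negatives --problem SmoothPoincare4`).  Refuter evidence on the item
(CRUX-ATTACK*.md, W.lean, W3.lean, 2026-08-15: SURVIVES; not vacuous — finger-move witness
`N = S² × S²`, `P = pt × S²`, `S = S² × pt` pushed twice through `P`; restates-target only in the
direction `SPC4 ⇒ crux`) is honoured: the finger-move witness inhabits every stub's hypotheses (its
undoing disc is a clean framed Whitney disc; the move returns the factor pair; Milnor returns `S⁴`).

Barriers (route technique_class: protocork-complexity-ladder, light-bulb, middle-level):
`Literature.Barriers.SmoothPoincare4.HCobordismBarrierFour` — the h-cobordism principle is never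
invoked; the Whitney disc is asked for ONE configuration class at `b₂(N) = 2` with homotopy-sphere
output, conceded FALSE at `b⁺ ≥ 1` (the bet of the route, unchanged); `RelativeContractibleBarrierFour`
/ `ContractibleBarrierFour` — not engaged (no extension of a boundary involution, no identification of
contractible pieces: a global isotopy inside `N`); `OneStabilisationBarrier` — not engaged by this crux
(it threatens ThreePointDescent, the sister crux).
-/

noncomputable section

-- every `Summit.SmoothPoincare4.SmoothPoincare4.…` name repeats the summit = sub-problem segment
-- (D-0017 layout); the duplicate is deliberate.
set_option linter.dupNamespace false
set_option linter.unusedVariables false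

namespace Summit.SmoothPoincare4.SmoothPoincare4.Cruxes.ThreePointCancellation.Birth

open scoped Manifold ContDiff Topology
open Set Function Literature.Topology.FourManifolds
open Summit.SmoothPoincare4.SmoothPoincare4.Theses.ThreePointSpheres (ThreePointCancellation
  OnePointCancellation)

/-- Local notation: the round `2`-sphere `S² ⊆ ℝ³` (model `𝓡 2`), source of the sphere families. -/
local notation "𝕊²" => (Metric.sphere (0 : EuclideanSpace ℝ (Fin 3)) 1)
/-- Local notation: the round `4`-sphere `S⁴ ⊆ ℝ⁵` (model `𝓡 4`). -/
local notation "𝕊⁴" => (Metric.sphere (0 : EuclideanSpace ℝ (Fin 5)) 1)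
/-- Local notation: the model space `ℝ⁴`. -/
local notation "𝔼⁴" => EuclideanSpace ℝ (Fin 4)

/-! ## §1 The stub SIGNATURES (`Sig.stub_<name>`; the skeleton audit reads the hypotheses of
`ThreePointCancellation_of` BY NAME, heads = stub names / route items) -/

/-- **STUB 1 — A CLEAN FRAMED WHITNEY DISC ON SOME THREE-POINT PRESENTATION OF `M` IN `N`** (OPEN;
the dual-invisible residue `w = 0` of the card's `(j, w)` grading = the route's foreseen child
`DualInvisibleVanishes`).  Hypotheses: VERBATIM those of the crux — `(M, e)` with the Statement's
binders, `N` closed simply connected smooth oriented, ONE algebraically dual pair `(S, P)` of framed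
2-spheres with exactly three double points, `P`-surgery `S⁴`, `S`-surgery `M`.  Conclusion: in the
same `N` there is an algebraically dual pair `(S₁, P₁)` (new sphere orientations `oS₁`, `oP₁` allowed),
again with exactly three double points, `P₁`-surgery `S⁴` and `S₁`-surgery `M`, and two of its double
points `q₁`, `q₂` carry a framed Whitney disc `W` (tree structure
`Literature.Topology.FourManifolds.FramedWhitneyDisc`, fixed sheet `S₁`, moved sheet `P₁`) whose
interior misses `S₁ ∪ P₁` (`W.interiorMeets = ∅`).  In print: `N ≅ S² × S²`, `P ≃ pt × S²`,
`[S] = [S² × pt]`; the statement is "the Whitney circle of a three-point sphere pair presenting a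
homotopy sphere can be capped by an embedded framed disc off the pair, after re-choosing the pair" —
the uncovered 'dual-invisible' configuration of the light-bulb theorems (Gabai2020 Thm. 1.9 needs a
COMMON transverse sphere met once).  Size: open-problem (= the crux's open weight).  Why it might fail:
SPC4 for P₀-twists (Ladu2025ComplexityTwo §1, Cor. 1.3); the `b⁺ ≥ 1` analogue is false (Akbulut cork).
[Gabai2020; Schwartz2021LightBulbDisks; KosanovicTeichner2021Disks; FreedmanQuinnPMS1990 §1.4;
Ladu2025ComplexityTwo] -/
def Sig.stub_cleanWhitneyDisc : Prop :=
  ∀ (M : Type) [TopologicalSpace M] [T2Space M] [SecondCountableTopology M] [ChartedSpace 𝔼⁴ M]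
    [IsManifold (𝓡 4) ∞ M] (_ : ContinuousMap.HomotopyEquiv M 𝕊⁴)
    (N : Type) [TopologicalSpace N] [T2Space N] [SecondCountableTopology N] [ChartedSpace 𝔼⁴ N]
    [IsManifold (𝓡 4) ∞ N] [CompactSpace N] [SimplyConnectedSpace N]
    (oN : SmoothOrientation (𝓡 4) N) (oS oP : SmoothOrientation (𝓡 2) 𝕊²)
    (S P : FramedSphereFamily (𝓡 4) N (Fin 1) 2 2),
    IsAlgebraicallyDual (𝓡 2) (𝓡 2) (𝓡 4) two_add_two_eq_four oS oP oN S.sphere P.sphere →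
    (doublePoints (S.sphere 0) (P.sphere 0)).ncard = 3 →
    P.IsSurgery (𝓡 4) 𝕊⁴ → S.IsSurgery (𝓡 4) M →
    ∃ (S₁ P₁ : FramedSphereFamily (𝓡 4) N (Fin 1) 2 2) (oS₁ oP₁ : SmoothOrientation (𝓡 2) 𝕊²),
      IsAlgebraicallyDual (𝓡 2) (𝓡 2) (𝓡 4) two_add_two_eq_four oS₁ oP₁ oN S₁.sphere P₁.sphere ∧
      (doublePoints (S₁.sphere 0) (P₁.sphere 0)).ncard = 3 ∧
      P₁.IsSurgery (𝓡 4) 𝕊⁴ ∧ S₁.IsSurgery (𝓡 4) M ∧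
      ∃ (q₁ q₂ : ↥𝕊² × ↥𝕊²)
        (W : FramedWhitneyDisc (𝓡 2) (𝓡 2) (𝓡 4) (S₁.sphere 0) (P₁.sphere 0) q₁ q₂),
        W.interiorMeets = ∅

/-- **STUB 2 — THE WHITNEY MOVE READ ON PRESENTATIONS** (known; the tree's PROVED Whitney move plus
transport of framed families and of the surgery relation along the end diffeomorphism).  For a smooth
`N⁴` (Hausdorff, second countable), ANY target manifolds `X₁`, `X₂` charted on `ℝ⁴`, orientations, and
an algebraically dual pair `(S, P)` of framed 2-spheres in `N` with exactly three double points,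
`P`-surgery `X₁`, `S`-surgery `X₂`: if two of the double points carry a framed Whitney disc `W` (fixed
sheet `S`, moved sheet `P`) with `W.interiorMeets = ∅`, then there is a GEOMETRICALLY dual pair
`(S', P')` of framed 2-spheres in `N` (algebraically dual with exactly one double point; new sphere
orientations allowed, `oN` kept) with `P'`-surgery `X₁` and `S'`-surgery `X₂`.  Proof sketch (all
ingredients in tree): `Φ` := the Whitney-move ambient isotopy of
`FreedmanQuinn1990_whitneyMove_holds` for `(S.sphere 0, P.sphere 0, q₁, q₂, W)` with support `O`
chosen off the third crossing; `S' := S`, `P' :=` push-forward of `P` along `Φ₁`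
(`FramedSphereFamily.exists_map_diffeomorph`); `P'.IsSurgery X₁` by `IsSurgery.of_map_diffeomorph`;
`doublePoints = {q₃}` by the move, transversality at `q₃` untouched, `S'·P' = ±1`
(`intersectionNumber_eq_one_or_eq_neg_one_of_doublePoints_eq_singleton`), sign fixed to `+1` by
`oP' := ±oP` (`intersectionNumber_neg_right`).  Size: M–L.  Why it might fail: only as typed.
[FreedmanQuinnPMS1990 §1.4; MilnorHCobordism1965 Thm. 6.6, Def. 3.11; Kirby1989 XII §1] -/
def Sig.stub_whitneyMoveToDual : Prop :=
  ∀ (N : Type) [TopologicalSpace N] [T2Space N] [SecondCountableTopology N] [ChartedSpace 𝔼⁴ N]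
    [IsManifold (𝓡 4) ∞ N]
    (X₁ : Type) [TopologicalSpace X₁] [ChartedSpace 𝔼⁴ X₁]
    (X₂ : Type) [TopologicalSpace X₂] [ChartedSpace 𝔼⁴ X₂]
    (oN : SmoothOrientation (𝓡 4) N) (oS oP : SmoothOrientation (𝓡 2) 𝕊²)
    (S P : FramedSphereFamily (𝓡 4) N (Fin 1) 2 2),
    IsAlgebraicallyDual (𝓡 2) (𝓡 2) (𝓡 4) two_add_two_eq_four oS oP oN S.sphere P.sphere →
    (doublePoints (S.sphere 0) (P.sphere 0)).ncard = 3 →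
    P.IsSurgery (𝓡 4) X₁ → S.IsSurgery (𝓡 4) X₂ →
    ∀ (q₁ q₂ : ↥𝕊² × ↥𝕊²)
      (W : FramedWhitneyDisc (𝓡 2) (𝓡 2) (𝓡 4) (S.sphere 0) (P.sphere 0) q₁ q₂),
      W.interiorMeets = ∅ →
      ∃ (S' P' : FramedSphereFamily (𝓡 4) N (Fin 1) 2 2) (oS' oP' : SmoothOrientation (𝓡 2) 𝕊²),
        IsGeometricallyDual (𝓡 2) (𝓡 2) (𝓡 4) two_add_two_eq_four oS' oP' oN S'.sphere P'.sphere ∧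
        P'.IsSurgery (𝓡 4) X₁ ∧ S'.IsSurgery (𝓡 4) X₂

/-! ## §2 The registered stubs (the ONLY `sorry`s of this file) -/

/-- Registered stub 1 (OPEN, the heart; open-problem): a clean framed Whitney disc on some three-point
presentation of `M` in `N`.  See `Sig.stub_cleanWhitneyDisc`. -/
theorem stub_cleanWhitneyDisc : Sig.stub_cleanWhitneyDisc := by
  sorry

/-- Registered stub 2 (known, M–L): the Whitney move across a clean framed disc turns a three-point
algebraically dual presentation into a geometrically dual one with the same surgery outcomes.  See
`Sig.stub_whitneyMoveToDual`. -/
theorem stub_whitneyMoveToDual : Sig.stub_whitneyMoveToDual := by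
  sorry

/-- Registered stub 3 (known, L): Milnor cancellation in the middle level = the route's support item
`ThreePointSpheres.OnePointCancellation` (stmt-SmoothPoincare4-11170) BY NAME — a geometrically dual
one-pair presentation of `M` from `S⁴` gives `M ≅ S⁴`.  Closing item 11170 closes this stub. -/
theorem stub_onePointCancellation : OnePointCancellation := by
  sorry

/-! ## §3 The composition — the crux BY NAME from the three stubs (real proof, no `sorry`) -/

/-- **Skeleton theorem.**  Clean Whitney disc, Whitney move and Milnor cancellation imply the crux
`Theses.ThreePointSpheres.ThreePointCancellation` BY NAME.  Fix `(M, e)`, `N`, orientations and the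
three-point pair `(S, P)` with its four hypotheses.  Stub 1 re-chooses the pair inside `N` and caps
its Whitney circle cleanly (`S₁, P₁, W`); stub 2 (at `X₁ = S⁴`, `X₂ = M`) moves `P₁` across `W` to a
geometrically dual pair `(S', P')` with the same surgeries; stub 3 cancels: `M ≅ S⁴`. -/
theorem ThreePointCancellation_of :
    Sig.stub_cleanWhitneyDisc → Sig.stub_whitneyMoveToDual → OnePointCancellation →
      ThreePointCancellation := by
  intro hDisc hMove hOne M _ _ _ _ _ e N _ _ _ _ _ _ _ oN oS oP S P hdual h3 hPS hSM
  -- stub 1: a three-point presentation of `M` in `N` with a clean framed Whitney disc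
  obtain ⟨S₁, P₁, oS₁, oP₁, hdual₁, h3₁, hPS₁, hSM₁, q₁, q₂, W, hW⟩ :=
    hDisc M e N oN oS oP S P hdual h3 hPS hSM
  -- stub 2: the Whitney move — a geometrically dual presentation with the same surgeries
  obtain ⟨S', P', oS', oP', hgeo, hPS', hSM'⟩ :=
    hMove N 𝕊⁴ M oN oS₁ oP₁ S₁ P₁ hdual₁ h3₁ hPS₁ hSM₁ q₁ q₂ W hW
  -- stub 3: Milnor cancellation
  exact hOne M e N oN oS' oP' S' P' hgeo hPS' hSM'

/-- The crux by name, closed modulo the three registered stubs (its axiom closure contains `sorryAx`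
through the stubs only; `ThreePointCancellation_of` itself is sorry-free). -/
theorem threePointCancellation_of_stubs : ThreePointCancellation :=
  ThreePointCancellation_of stub_cleanWhitneyDisc stub_whitneyMoveToDual stub_onePointCancellation

end Summit.SmoothPoincare4.SmoothPoincare4.Cruxes.ThreePointCancellation.Birth

end
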